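import Summits.AnomalousDissipation.AnomalousDissipation.Theses.RuelleSaturation

/-!
# Birth skeleton for piece W = `WindowDissipationFloor` (split child 1/3 of KolmogorovHorizonChaos)

Two named stubs and the kernel-checked `WindowDissipationFloor_of`:
* `stub_workFloorWindows` — the PHYSICS in injection form: the same level-wise smooth bounded-energy window
  witnesses, but with a WORK floor `∫₀ᴸ∫⟪f, u⟫ ≥ c·L` (the velocity keeps absorbing power from the steady
  force at rate `c` on arbitrarily long windows; re-chosen data, no global solution per level);
* `stub_windowEnergyBalance` — the integrated classical energy balance on a window (known: Doering–Foias 2002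
  §2 (2.4); tree fact `IsClassicalNSSolutionOn.energy_balance_holds` + FTC for the continuous derivative).
The composition turns work into dissipation: `ν∫₀ᴸ‖∇u‖² = E(0) − E(L) + work ≥ −E₀/2 + cL ≥ (c/2)L` for `L ≥ E₀/c`.
-/

open MeasureTheory Filter Topology Set

noncomputable section

namespace Summit.AnomalousDissipation.AnomalousDissipation.Cruxes.KolmogorovHorizonChaos.SplitWindowCapture.WindowBirth

/-- Piece W, verbatim (split child 1/3). -/
def WindowDissipationFloor : Prop :=
  ∃ f : UnitAddTorus (Fin 3) → EuclideanSpace ℝ (Fin 3), Literature.Analysis.FunctionSpaces.Torus.IsSmooth f ∧ Literature.Analysis.FunctionSpaces.Torus.IsDivFree f ∧ Literature.Analysis.FunctionSpaces.Torus.HasZeroMean f ∧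
  ∃ ν : ℕ → ℝ, (∀ j, 0 < ν j ∧ ν j ≤ 1) ∧ Filter.Tendsto ν Filter.atTop (nhds 0) ∧
  ∃ E₀ c L₁ : ℝ, 0 < c ∧ ∀ j, ∃ B : ℕ → ℝ, ∀ L : ℝ, L₁ ≤ L →
    ∃ (u : ℝ → UnitAddTorus (Fin 3) → EuclideanSpace ℝ (Fin 3)) (p : ℝ → UnitAddTorus (Fin 3) → ℝ),
      Literature.Analysis.FunctionSpaces.Torus.IsSmoothSpaceTimeOn Set.univ u ∧ Literature.Analysis.FunctionSpaces.Torus.IsSmoothSpaceTimeOn Set.univ p ∧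
      (∀ t, Literature.Analysis.FunctionSpaces.Torus.IsDivFree (u t)) ∧
      Literature.Analysis.FunctionSpaces.Torus.IsClassicalNSSolutionOn (Set.Icc 0 L) (ν j) (fun _ => f) u p ∧
      (∀ t ∈ Set.Icc 0 L, MeasureTheory.integral MeasureTheory.volume (fun x : UnitAddTorus (Fin 3) => ‖u t x‖ ^ 2) ≤ E₀) ∧
      (∀ k : ℕ, ∀ q ∈ (Set.Icc 0 L) ×ˢ (Set.univ : Set (EuclideanSpace ℝ (Fin 3))),
        ‖iteratedFDeriv ℝ k (Literature.Analysis.FunctionSpaces.Torus.stLift u) q‖ ≤ B k ∧ ‖iteratedFDeriv ℝ k (Literature.Analysis.FunctionSpaces.Torus.stLift p) q‖ ≤ B k) ∧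
      c * L ≤ ν j * ∫ t in (0 : ℝ)..L, Literature.Analysis.FunctionSpaces.Torus.gradNormSq (u t)

/-- STUB 1 (the physics, injection form): level-wise smooth bounded-energy windows with a WORK floor. -/
theorem stub_workFloorWindows :
    ∃ f : UnitAddTorus (Fin 3) → EuclideanSpace ℝ (Fin 3), Literature.Analysis.FunctionSpaces.Torus.IsSmooth f ∧ Literature.Analysis.FunctionSpaces.Torus.IsDivFree f ∧ Literature.Analysis.FunctionSpaces.Torus.HasZeroMean f ∧
    ∃ ν : ℕ → ℝ, (∀ j, 0 < ν j ∧ ν j ≤ 1) ∧ Filter.Tendsto ν Filter.atTop (nhds 0) ∧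
    ∃ E₀ c L₁ : ℝ, 0 < c ∧ ∀ j, ∃ B : ℕ → ℝ, ∀ L : ℝ, L₁ ≤ L →
    ∃ (u : ℝ → UnitAddTorus (Fin 3) → EuclideanSpace ℝ (Fin 3)) (p : ℝ → UnitAddTorus (Fin 3) → ℝ),
    Literature.Analysis.FunctionSpaces.Torus.IsSmoothSpaceTimeOn Set.univ u ∧ Literature.Analysis.FunctionSpaces.Torus.IsSmoothSpaceTimeOn Set.univ p ∧
    (∀ t, Literature.Analysis.FunctionSpaces.Torus.IsDivFree (u t)) ∧
    Literature.Analysis.FunctionSpaces.Torus.IsClassicalNSSolutionOn (Set.Icc 0 L) (ν j) (fun _ => f) u p ∧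
    (∀ t ∈ Set.Icc 0 L, MeasureTheory.integral MeasureTheory.volume (fun x : UnitAddTorus (Fin 3) => ‖u t x‖ ^ 2) ≤ E₀) ∧
    (∀ k : ℕ, ∀ q ∈ (Set.Icc 0 L) ×ˢ (Set.univ : Set (EuclideanSpace ℝ (Fin 3))),
    ‖iteratedFDeriv ℝ k (Literature.Analysis.FunctionSpaces.Torus.stLift u) q‖ ≤ B k ∧ ‖iteratedFDeriv ℝ k (Literature.Analysis.FunctionSpaces.Torus.stLift p) q‖ ≤ B k) ∧
    c * L ≤ ∫ t in (0 : ℝ)..L, MeasureTheory.integral MeasureTheory.volume (fun x : UnitAddTorus (Fin 3) => inner ℝ (f x) (u t x)) := by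
  sorry

/-- STUB 2 (known): integrated energy balance of a classical solution on the window `[0, L]`. -/
theorem stub_windowEnergyBalance :
    ∀ (ν : ℝ) (f : UnitAddTorus (Fin 3) → EuclideanSpace ℝ (Fin 3)) (u : ℝ → UnitAddTorus (Fin 3) → EuclideanSpace ℝ (Fin 3))
      (p : ℝ → UnitAddTorus (Fin 3) → ℝ) (L : ℝ), 0 ≤ L →
      Literature.Analysis.FunctionSpaces.Torus.IsSmoothSpaceTimeOn Set.univ u →
      Literature.Analysis.FunctionSpaces.Torus.IsClassicalNSSolutionOn (Set.Icc 0 L) ν (fun _ => f) u p →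
      ν * ∫ t in (0 : ℝ)..L, Literature.Analysis.FunctionSpaces.Torus.gradNormSq (u t) =
        Literature.Analysis.FunctionSpaces.Torus.kineticEnergy (u 0) - Literature.Analysis.FunctionSpaces.Torus.kineticEnergy (u L) +
          ∫ t in (0 : ℝ)..L, MeasureTheory.integral MeasureTheory.volume (fun x : UnitAddTorus (Fin 3) => inner ℝ (f x) (u t x)) := by
  sorry

/-- Composition (no sorry outside the stubs): work floor + energy balance + bounded energy ⇒ dissipation floor `(c/2)·L`
for `L ≥ max (max L₁ 0) (E₀/c)`. -/
theorem WindowDissipationFloor_of : WindowDissipationFloor := by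
  obtain ⟨f, hfs, hfd, hfm, ν, hν, hν0, E₀, c, L₁, hc, H⟩ := stub_workFloorWindows
  refine ⟨f, hfs, hfd, hfm, ν, hν, hν0, E₀, c / 2, max (max L₁ 0) (E₀ / c), half_pos hc, fun j => ?_⟩
  obtain ⟨B, hB⟩ := H j
  refine ⟨B, fun L hL => ?_⟩
  have hL1 : L₁ ≤ L := le_trans (le_trans (le_max_left _ _) (le_max_left _ _)) hL
  have hL0 : 0 ≤ L := le_trans (le_trans (le_max_right _ _) (le_max_left _ _)) hL
  have hLE : E₀ / c ≤ L := le_trans (le_max_right _ _) hL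
  have hLE' : E₀ ≤ c * L := by rwa [div_le_iff₀' hc] at hLE
  obtain ⟨u, p, hu, hp, hdiv, hNS, hEn, hBud, hwork⟩ := hB L hL1
  refine ⟨u, p, hu, hp, hdiv, hNS, hEn, hBud, ?_⟩
  have hbal := stub_windowEnergyBalance (ν j) f u p L hL0 hu hNS
  have hE0 : 0 ≤ Literature.Analysis.FunctionSpaces.Torus.kineticEnergy (u 0) :=
    Literature.Analysis.FunctionSpaces.Torus.kineticEnergy_nonneg _
  have hEL : Literature.Analysis.FunctionSpaces.Torus.kineticEnergy (u L) ≤ E₀ / 2 := by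
    have := hEn L ⟨hL0, le_rfl⟩
    unfold Literature.Analysis.FunctionSpaces.Torus.kineticEnergy
    linarith
  rw [hbal]
  linarith

end Summit.AnomalousDissipation.AnomalousDissipation.Cruxes.KolmogorovHorizonChaos.SplitWindowCapture.WindowBirth

end
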